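import Mathlib
import HarnessLib
import Summits.NavierStokesRegularity.NavierStokesRegularity.Theorems.PoloidalWindowDoorPoloidalWindowRigidityHotLoopsPeakless

/-!
# Item `LrcModEntire` (stmt-NavierStokesRegularity-20428), skeleton twist_split v6 — the (TH) column CONDITIONAL ON THE WALL ⟨27893⟩ reduces to the RIDGE THREAD:
# `stub_twistingTHGerm` ⇐ `FrequencyGrowthExponent` ∧ «ridge residue» (the hot spot is a NON-STRICT planar maximum: the hot set accumulates at the thread)

Cell ns-regularity-ideate, LEAD ns-poloidal-K2-p3 g13 (`--supports stmt-NavierStokesRegularity-20428`; memo OSC-LIOUVILLE-g13 v1.6 §5octies).  LEAD synthesis of the two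
K2 lines: ns-idea-8 / K2-p2's `hot_loops` gives, MODULO the wall `LoopPeriodRatchet.FrequencyGrowthExponent` (item stmt-NavierStokesRegularity-27893, OPEN, a NAMED
hypothesis), `…HotLoopsPeakless.zero_of_strictPlanarExtremum`: a strict local planar extremum of `±v₂` anywhere kills a class poloidal profile.  The (OSC) road's wall
(BRANCH) wants exactly a NON-DEGENERATE (hence strict) plane-maximum branch through the thread.  So the two regimes are complementary, and under ⟨27893⟩ the
(TH) column shrinks to the RIDGE THREAD: the hot spot `(−1,0)` is a planar maximum of `v₂(−1,·)|_{y₂=0}` that is NOT strict — by the hot-spot bound this means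
`v₂(−1,y′) = v₂(−1,0)` for points `y′ ≠ 0` of the thread plane arbitrarily close to `0` (for the real-analytic slice: the hot set `{v₂(−1,·,0) = N}` is a perfect
analytic set through `0`, a union of curves — a ridge of constant height `N` along which `∇v₂ = 0`, `ω = 0`, and every hot-spot pin holds).
* `twistingTHGerm_of_growth_of_ridge` — the registered signature of `stub_twistingTHGerm` VERBATIM from `hG : FrequencyGrowthExponent` and the RIDGE RESIDUE
  `hRidge` (the stub's binders + «`v₂(−1,y′) = v₂(−1,0)` frequently in the punctured thread plane near `0`» ⇒ the stub's conclusion).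
Proof: if `0` is a strict planar max of `σ·v₂(−1,·)` (`σ = ±1` the sign of `v₂(−1,0)`), `zero_of_strictPlanarExtremum hG` gives `v ≡ 0`, contradicting
`v₂(−1,0) ≠ 0`; otherwise the hot-spot bound `|v₂(−1,y′)| ≤ |v₂(−1,0)|` turns «not strictly smaller, frequently» into «equal, frequently» and `hRidge` ends.

WHAT THIS IS NOT: not a claim about Navier–Stokes regularity and not a proof of the stub — a CONDITIONAL (named hypothesis ⟨27893⟩) reduction BY NAME to a typed residue
(bears_on LADDER-NS N0, item 20428 / crux 19708; 20428, 19708, 27893 OPEN).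
-/

noncomputable section

-- the summit and its single sub-problem share the name (CONVENTIONS §1), as in every Theorems file
set_option linter.dupNamespace false

namespace Summit.NavierStokesRegularity.NavierStokesRegularity.Theorems.PoloidalWindowDoorLrcModEntireTwistingTHRidgeThread

open Set Filter Topology Function Metric
open scoped RealInnerProductSpace InnerProductSpace Laplacian
open Literature.Analysis Literature.Analysis.FluidPDE
open Summit.NavierStokesRegularity.NavierStokesRegularity.Theorems.PoloidalWindowDoorPoloidalWindowRigidityHotLoopsPeakless

/-- **THE (TH) COLUMN UNDER THE WALL ⟨27893⟩ IS THE RIDGE THREAD.**  From `hG : FrequencyGrowthExponent` (item 27893, NAMED HYPOTHESIS) and the ridge residue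
`hRidge` (the binders of `stub_twistingTHGerm` plus «the hot value `v₂(−1,0)` is taken again at points of the punctured thread plane arbitrarily close to `0`»
⇒ the stub's conclusion), the registered signature of `stub_twistingTHGerm` (skeleton `Cruxes/LrcModEntire/Lines/twist_split.lean` v6) follows. -/
theorem twistingTHGerm_of_growth_of_ridge
    (hG : Summit.NavierStokesRegularity.NavierStokesRegularity.Theses.LoopPeriodRatchet.FrequencyGrowthExponent)
    (hRidge :
    ∀ (C : ℝ) (v : ℝ → EuclideanSpace ℝ (Fin 3) → EuclideanSpace ℝ (Fin 3)),
      Literature.Analysis.FluidPDE.HasTypeITimeDecay C v →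
      ContinuousOn (Function.uncurry v) (Set.Iio (0 : ℝ) ×ˢ Set.univ) →
      (∀ s t : ℝ, s < t → t < 0 → ∀ x, v t x =
        Literature.Analysis.UnboundedOperators.heatExtension (v s) (t - s) x -
          Literature.Analysis.FluidPDE.oseenDuhamel 1 s v v t x) →
      (∀ t < 0, Literature.Analysis.FluidPDE.VectorCalculus.IsDivFree (v t)) →
      (∀ s < 0, ∀ y, ⟪Literature.Analysis.FluidPDE.curl (v s) y, EuclideanSpace.single 2 1⟫_ℝ = 0) →
      v (-1) 0 2 ≠ 0 → (∀ t < 0, ∀ x, Real.sqrt (-t) * |v t x 2| ≤ |v (-1) 0 2|) →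
      (∀ h : EuclideanSpace ℝ (Fin 3), fderiv ℝ (v (-1)) 0 h 2 = 0) →
      (deriv (fun s => v s 0 2) (-1) = v (-1) 0 2 / 2 ∧ v (-1) 0 2 * (Δ (fun y => v (-1) y 2)) 0 ≤ 0) →
      ∀ W : Set (ℝ × EuclideanSpace ℝ (Fin 3)), IsOpen W → W.Nonempty → W ⊆ Set.Iio (0 : ℝ) ×ˢ Set.univ →
        (∀ z ∈ W, (Literature.Analysis.FluidPDE.curl (v z.1) z.2 ≠ 0 ∧
            (fderiv ℝ (v z.1) z.2 (EuclideanSpace.single 0 1) 2 ≠ 0 ∨ fderiv ℝ (v z.1) z.2 (EuclideanSpace.single 1 1) 2 ≠ 0) ∧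
            (fderiv ℝ (v z.1) z.2 (EuclideanSpace.single 2 1) 0 ≠ 0 ∨ fderiv ℝ (v z.1) z.2 (EuclideanSpace.single 2 1) 1 ≠ 0))) →
        (∀ m : ℝ → ℝ, ∀ W₁ : Set (ℝ × EuclideanSpace ℝ (Fin 3)), W₁ ⊆ W → IsOpen W₁ → W₁.Nonempty →
            ∃ z ∈ W₁, ∃ b : Fin 3, b ≠ 2 ∧
              fderiv ℝ (v z.1) z.2 (EuclideanSpace.single 2 1) b ≠
                m z.1 * fderiv ℝ (v z.1) z.2 (EuclideanSpace.single b 1) 2) →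
        (∀ z ∈ W, (fderiv ℝ (fun x => fderiv ℝ (v z.1) x (EuclideanSpace.single 2 1) 2) z.2 (EuclideanSpace.single 0 1) *
                fderiv ℝ (v z.1) z.2 (EuclideanSpace.single 1 1) 2 -
              fderiv ℝ (fun x => fderiv ℝ (v z.1) x (EuclideanSpace.single 2 1) 2) z.2 (EuclideanSpace.single 1 1) *
                fderiv ℝ (v z.1) z.2 (EuclideanSpace.single 0 1) 2 ≠ 0)) →
        (∃ m : ℝ → ℝ → ℝ, ∀ z ∈ W, ∀ b : Fin 3, b ≠ 2 →
            fderiv ℝ (v z.1) z.2 (EuclideanSpace.single 2 1) b =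
              m z.1 (z.2 2) * fderiv ℝ (v z.1) z.2 (EuclideanSpace.single b 1) 2) →
        (∃ᶠ y' in nhdsWithin (0 : EuclideanSpace ℝ (Fin 3)) {y' | y' 2 = 0 ∧ y' ≠ 0}, v (-1) y' 2 = v (-1) 0 2) →
        ∃ s : ℝ, s < 0 ∧ ∃ U : Set (EuclideanSpace ℝ (Fin 3)), IsOpen U ∧ U.Nonempty ∧
          ((∃ e : EuclideanSpace ℝ (Fin 3), e ≠ 0 ∧
              ∀ y ∈ U, fderiv ℝ (Literature.Analysis.FluidPDE.curl (v s)) y e = 0) ∨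
           (∃ c : EuclideanSpace ℝ (Fin 3), ∀ y ∈ U,
              Literature.Analysis.FluidPDE.rotGen (Literature.Analysis.FluidPDE.curl (v s) y) =
                fderiv ℝ (Literature.Analysis.FluidPDE.curl (v s)) y (Literature.Analysis.FluidPDE.rotGen (y - c))) ∨
           (∃ w : EuclideanSpace ℝ (Fin 3) → EuclideanSpace ℝ (Fin 3), AnalyticOnNhd ℝ w Set.univ ∧
              ¬ BddAbove (Set.range fun y => ‖w y‖) ∧ ∀ y ∈ U, v s y = w y)) ) :
    ∀ (C : ℝ) (v : ℝ → EuclideanSpace ℝ (Fin 3) → EuclideanSpace ℝ (Fin 3)),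
      Literature.Analysis.FluidPDE.HasTypeITimeDecay C v →
      ContinuousOn (Function.uncurry v) (Set.Iio (0 : ℝ) ×ˢ Set.univ) →
      (∀ s t : ℝ, s < t → t < 0 → ∀ x, v t x =
        Literature.Analysis.UnboundedOperators.heatExtension (v s) (t - s) x -
          Literature.Analysis.FluidPDE.oseenDuhamel 1 s v v t x) →
      (∀ t < 0, Literature.Analysis.FluidPDE.VectorCalculus.IsDivFree (v t)) →
      (∀ s < 0, ∀ y, ⟪Literature.Analysis.FluidPDE.curl (v s) y, EuclideanSpace.single 2 1⟫_ℝ = 0) →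
      v (-1) 0 2 ≠ 0 → (∀ t < 0, ∀ x, Real.sqrt (-t) * |v t x 2| ≤ |v (-1) 0 2|) →
      (∀ h : EuclideanSpace ℝ (Fin 3), fderiv ℝ (v (-1)) 0 h 2 = 0) →
      (deriv (fun s => v s 0 2) (-1) = v (-1) 0 2 / 2 ∧ v (-1) 0 2 * (Δ (fun y => v (-1) y 2)) 0 ≤ 0) →
      ∀ W : Set (ℝ × EuclideanSpace ℝ (Fin 3)), IsOpen W → W.Nonempty → W ⊆ Set.Iio (0 : ℝ) ×ˢ Set.univ →
        (∀ z ∈ W, (Literature.Analysis.FluidPDE.curl (v z.1) z.2 ≠ 0 ∧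
            (fderiv ℝ (v z.1) z.2 (EuclideanSpace.single 0 1) 2 ≠ 0 ∨ fderiv ℝ (v z.1) z.2 (EuclideanSpace.single 1 1) 2 ≠ 0) ∧
            (fderiv ℝ (v z.1) z.2 (EuclideanSpace.single 2 1) 0 ≠ 0 ∨ fderiv ℝ (v z.1) z.2 (EuclideanSpace.single 2 1) 1 ≠ 0))) →
        (∀ m : ℝ → ℝ, ∀ W₁ : Set (ℝ × EuclideanSpace ℝ (Fin 3)), W₁ ⊆ W → IsOpen W₁ → W₁.Nonempty →
            ∃ z ∈ W₁, ∃ b : Fin 3, b ≠ 2 ∧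
              fderiv ℝ (v z.1) z.2 (EuclideanSpace.single 2 1) b ≠
                m z.1 * fderiv ℝ (v z.1) z.2 (EuclideanSpace.single b 1) 2) →
        (∀ z ∈ W, (fderiv ℝ (fun x => fderiv ℝ (v z.1) x (EuclideanSpace.single 2 1) 2) z.2 (EuclideanSpace.single 0 1) *
                fderiv ℝ (v z.1) z.2 (EuclideanSpace.single 1 1) 2 -
              fderiv ℝ (fun x => fderiv ℝ (v z.1) x (EuclideanSpace.single 2 1) 2) z.2 (EuclideanSpace.single 1 1) *
                fderiv ℝ (v z.1) z.2 (EuclideanSpace.single 0 1) 2 ≠ 0)) →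
        (∃ m : ℝ → ℝ → ℝ, ∀ z ∈ W, ∀ b : Fin 3, b ≠ 2 →
            fderiv ℝ (v z.1) z.2 (EuclideanSpace.single 2 1) b =
              m z.1 (z.2 2) * fderiv ℝ (v z.1) z.2 (EuclideanSpace.single b 1) 2) →
        ∃ s : ℝ, s < 0 ∧ ∃ U : Set (EuclideanSpace ℝ (Fin 3)), IsOpen U ∧ U.Nonempty ∧
          ((∃ e : EuclideanSpace ℝ (Fin 3), e ≠ 0 ∧
              ∀ y ∈ U, fderiv ℝ (Literature.Analysis.FluidPDE.curl (v s)) y e = 0) ∨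
           (∃ c : EuclideanSpace ℝ (Fin 3), ∀ y ∈ U,
              Literature.Analysis.FluidPDE.rotGen (Literature.Analysis.FluidPDE.curl (v s) y) =
                fderiv ℝ (Literature.Analysis.FluidPDE.curl (v s)) y (Literature.Analysis.FluidPDE.rotGen (y - c))) ∨
           (∃ w : EuclideanSpace ℝ (Fin 3) → EuclideanSpace ℝ (Fin 3), AnalyticOnNhd ℝ w Set.univ ∧
              ¬ BddAbove (Set.range fun y => ‖w y‖) ∧ ∀ y ∈ U, v s y = w y)) := by
  intro C v hrate hcont hmild hdiv hpol hne hhot hthread hpins W hW hWne hWs hnd hpin htw hTH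
  -- the sign of the hot value
  set N := v (-1) 0 2 with hN
  set σ : ℝ := if 0 < N then 1 else -1 with hσ
  have hσ1 : σ = 1 ∨ σ = -1 := by
    by_cases h : 0 < N
    · left; simp [hσ, h]
    · right; simp [hσ, h]
  have hσN : σ * N = |N| := by
    by_cases h : 0 < N
    · simp [hσ, h, abs_of_pos h]
    · have h' : N < 0 := lt_of_le_of_ne (not_lt.1 h) hne
      simp [hσ, h, abs_of_neg h']
  -- the hot-spot bound on the slice `−1`: `σ·v₂(−1,y′) ≤ σ·N`
  have hbound : ∀ y' : EuclideanSpace ℝ (Fin 3), σ * v (-1) y' 2 ≤ σ * N := by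
    intro y'
    have h1 : |v (-1) y' 2| ≤ |N| := by simpa using hhot (-1) (by norm_num) y'
    have h2 : σ * v (-1) y' 2 ≤ |v (-1) y' 2| := by
      rcases hσ1 with h | h
      · rw [h, one_mul]; exact le_abs_self _
      · rw [h, neg_one_mul]; exact neg_le_abs _
    rw [hσN]; exact h2.trans h1
  by_cases hstrict : ∀ᶠ y' in nhdsWithin (0 : EuclideanSpace ℝ (Fin 3)) {y' | y' 2 = (0 : EuclideanSpace ℝ (Fin 3)) 2 ∧ y' ≠ 0},
      σ * v (-1) y' 2 < σ * v (-1) 0 2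
  · -- strict planar extremum at the thread: the wall kills the profile
    have hzero := zero_of_strictPlanarExtremum hG C v hrate hcont hmild hdiv hpol (-1) σ 0 (by norm_num) hσ1 hstrict
    have h0 : v (-1) 0 = 0 := hzero (-1) (by norm_num) 0
    have hN0 : N = 0 := by rw [hN, h0]; rfl
    exact absurd hN0 hne
  · -- non-strict: the hot value recurs in the punctured thread plane near `0` — the ridge residue
    have hfreq : ∃ᶠ y' in nhdsWithin (0 : EuclideanSpace ℝ (Fin 3)) {y' | y' 2 = 0 ∧ y' ≠ 0}, v (-1) y' 2 = v (-1) 0 2 := by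
      have h02 : (0 : EuclideanSpace ℝ (Fin 3)) 2 = 0 := rfl
      rw [h02] at hstrict
      have h1 : ∃ᶠ y' in nhdsWithin (0 : EuclideanSpace ℝ (Fin 3)) {y' | y' 2 = 0 ∧ y' ≠ 0}, ¬ σ * v (-1) y' 2 < σ * v (-1) 0 2 :=
        Filter.not_eventually.1 hstrict
      refine h1.mono fun y' hy' => ?_
      have hle : σ * v (-1) y' 2 ≤ σ * N := hbound y'
      have hge : σ * N ≤ σ * v (-1) y' 2 := not_lt.1 hy'
      have heq : σ * v (-1) y' 2 = σ * N := le_antisymm hle hge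
      rcases hσ1 with h | h
      · rw [h, one_mul, one_mul] at heq; exact heq
      · rw [h, neg_one_mul, neg_one_mul] at heq; exact neg_injective heq
    exact hRidge C v hrate hcont hmild hdiv hpol hne hhot hthread hpins W hW hWne hWs hnd hpin htw hTH hfreq

end Summit.NavierStokesRegularity.NavierStokesRegularity.Theorems.PoloidalWindowDoorLrcModEntireTwistingTHRidgeThread
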